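/-
Copyright (c) 2026 the pub-hodgecm-mathlib formalisation cell (harness21).  Prover seat hodgecm-mathlib-B-p14 (g36): road «S3-tree» (LEAD F0P3a-plan (g11), architect A-p16 (g29)),
brick T1e «VALENCIES OF THE `U(3)` LATTICE TREE», FILE V5 = THE INERT-PLACE DRESS: the residual-Frobenius binders discharged at an inert place of a quadratic extension of
number fields; 2026-09-01.  Sequel of ★ V4 `UnitaryLatticeTreeValency`.
-/
import Literature.NumberTheory.Automorphic.UnitaryLatticeTreeValency                             -- ★ T1e V4 (B-p14 (g36)): `finite_neighborSet`, `ncard_neighborSet_eq_typeFun`, spheres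
import Literature.NumberTheory.Automorphic.HyperspecialUnitaryCartanAdicCompletion                -- ★ `UnitaryGroup.unramifiedLocalConjDatum_adicCompletion`; `galAdicCompletionMap`, `PlacesOver`
import Literature.NumberTheory.Automorphic.Liu2021.LemD1AsPrintedIndexedNonVacuityInertConverse   -- ★ `valued_galAdicCompletionMap_sub_pow_lt_one` (`σ_w ≡ Frob_{q_v}` on `𝒪_w`, `Valued` currency)
import Literature.NumberTheory.Automorphic.Liu2021.LemD1AsPrintedIndexedNonVacuityInertFrobenius  -- ★ `card_residueField_eq_sq` (`|𝓞_E ∕ 𝔭_w| = q_v²`)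
import Literature.RingTheory.DiscreteValuationRing.AdicCompletionResidueField                     -- ★ `natCard_residueField_adicCompletion` (`|𝓀[E_w]| = |𝓞_E ∕ 𝔭_w|`), `Finite 𝓀[E_w]`
import HarnessLib

/-!
# The lattice graph of a hermitian space — T1e FILE V5: AT AN INERT PLACE `w ∣ v` OF A QUADRATIC EXTENSION `E ∕ F` OF NUMBER FIELDS THE `U(3)` LATTICE TREE OF
# `(E_w³, J₀)` IS `(q_v³+1, q_v+1)`-BI-REGULAR — the residual binders `hσO`, `σk`, `hσk`, `|𝓀| = q²`, `σk = Frob_q` of ★ V2b–V4 DISCHARGED (Neukirch II (4.3); Tits 1979 §2.4)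

Topic `NumberTheory/Automorphic`; namespace `Literature.NumberTheory.Automorphic.UnitaryLatticeTree`.  THEOREMS ONLY (no definition, no instance, no notation, no named fact,
no `sorry`); kernel lane.  Cell `pub/hodgecm-mathlib` (D-0151), crux H413 = `stmt-HodgeConjecture-24833`; road «S3-tree», brick **T1e «VALENCIES»**, FILE V5: the END-side
dress.  ★ V2b–V4 count the stars of the lattice tree `latticeGraph σ ϖ J₀` over an abstract `K` with `Valued K ℤᵐ⁰` under the residual-involution binders of the cell's
★ `UnitaryGroupReductionSurjective` currency — `hσO : σ 𝒪 ⊆ 𝒪`, `σk : 𝓀 →+* 𝓀` with `hσk : σk (x mod 𝔭) = σ x mod 𝔭`, `Fintype.card 𝓀 = q²`, `σk y = y^q`.  HERE these are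
DISCHARGED at the END's places: `K = E_w := w.1.adicCompletion E` (Mathlib `Valued … ℤᵐ⁰`), `σ = σ_w := galAdicCompletionMap c hw` for a quadratic `E ∕ F`, `c ∈ Gal(E ∕ F)`,
`c ≠ 1`, `v` UNRAMIFIED in `E`, `w ∣ v` with `c • w = w` (INERT), `q_v = |𝓞_F ∕ 𝔭_v|` — in the `Valued` presentation `𝒪[E_w] = Valued.integer`, `𝓀[E_w] = Valued.ResidueField`
that ★ T1a `UnitaryLatticeTreeDefs` and ★ `UnramifiedLocalConjDatum` live in (the cell's ★ `UnitaryGroupIntegralPointsReductionInert` §3 is the `ValuativeRel` presentation of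
the same facts; the two integer rings coincide, ★ `integer_valuation_eq_adicCompletionIntegers`, but the consumers of T1 need the `Valued` one verbatim).

THE MATHEMATICS.  (§1, any `K`) a VALUATION-PRESERVING endomorphism `σ` maps `𝒪` to `𝒪` and `𝔪` to `𝔪`, hence reduces to `σk := Ideal.quotientMap 𝔪 σ|_𝒪 : 𝓀 →+* 𝓀` with
`σk (x mod 𝔪) = σ x mod 𝔪`.  (§2, inert `w`) `σ_w` preserves `v_w` (★ `valued_galAdicCompletionMap`); EVERY reduction `σk` of `σ_w` is `y ↦ y^{q_v}` because
`v_w(σ_w x − x^{q_v}) < 1` on `𝒪_w` (★ `valued_galAdicCompletionMap_sub_pow_lt_one`: density of `𝓞_E` + the global congruence `c u ≡ u^{q_v} mod 𝔭_w`); and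
`|𝓀[E_w]| = |𝓞_E ∕ 𝔭_w| = q_v²` (★ `natCard_residueField_adicCompletion`, ★ `card_residueField_eq_sq`: `f(w|v) = 2`).  (§3) Feeding ★ V4: for every uniformiser `ϖ` with
`hd : UnramifiedLocalConjDatum σ_w ϖ` (one exists, ★ `UnitaryGroup.unramifiedLocalConjDatum_adicCompletion`), the lattice tree `G = latticeGraph σ_w ϖ J₀` of `E_w³` has FINITE
stars, `#star(v) = q_v³ + 1` at self-dual and `q_v + 1` at type-two vertices (`(G.neighborSet v).ncard = ![q_v³, q_v] (t v) + 1` for any type function `t`), and the spheres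
`#S_m(L) = (q_v³+1) q_v^{⌊m∕2⌋} q_v^{3⌊(m−1)∕2⌋}` around a hyperspecial `L` (`q_v⁴ + q_v` at `m = 2`).

* §1 `map_mem_integer_of_v_eq` (`hσO`), **`exists_residueField_ringHom_of_v_eq`** (`σk`, `hσk`) — any `K`, `Valued K ℤᵐ⁰`, `σ` valuation-preserving.
* §2 `galAdicCompletionMap_mem_valuedInteger`, **`residueHom_galAdicCompletionMap_eq_pow_valued`** (`hfrob`), **`fintypeCard_valuedResidueField_eq_sq_of_inert`** (`hk`).
* §3 THE INERT-PLACE HEADS: **`finite_neighborSet_inert`**, **`ncard_neighborSet_eq_typeFun_inert`**, `ncard_neighborSet_of_isSelfDualLattice_inert` (`q_v³ + 1`),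
  `ncard_neighborSet_of_isVertexLattice_two_inert` (`q_v + 1`), `ncard_sphere_of_isSelfDualLattice_inert`, `ncard_sphere_two_of_isSelfDualLattice_inert` (`q_v⁴ + q_v`).

HONEST LABEL: HC_CM is proved only modulo the 2 remaining named inputs (hLiu418 24832, h413 24833) until rung 0 closes; nothing printed is asserted here; S3 (`stub_N6nsS3id`)
stays a print row until the road's END lands.

## References
* [NeukirchANT1999] J. Neukirch, *Algebraic Number Theory* (1999), Ch. I §8 Prop. (8.2) (`|𝓞∕𝔓| = q^f`), Ch. II §4 Prop. (4.3) (unramified extensions of local fields ↔ residue extensions; Frobenius).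
* [Tits1979] J. Tits, *Reductive groups over local fields*, PSPM 33.1 (1979), §2.4 (quasi-split `U(3)`: local index `(q³+1, q+1)` at an inert place).
* [BruhatTits1972] F. Bruhat, J. Tits, *Groupes réductifs sur un corps local I*, Publ. Math. IHÉS 41 (1972), §10.
* [Serre1980Trees] J.-P. Serre, *Trees* (1980), Ch. II §1.1.
-/

set_option autoImplicit false

noncomputable section

open scoped Valued WithZero Matrix MatrixGroups

namespace Literature.NumberTheory.Automorphic.UnitaryLatticeTree

open Literature.NumberTheory.Automorphic Literature.NumberTheory.Automorphic.HermitianLattice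
open Literature.NumberTheory.Automorphic.CartanUnique

/-! ## §1 A valuation-preserving endomorphism reduces to the residue field (`Valued` presentation) -/

section Generic

variable {K : Type*} [Field K] [Valued K ℤᵐ⁰] {σ : K →+* K}

/-- **`hσO`**: a valuation-preserving `σ` maps `𝒪 = Valued.integer` into itself. [cite: NeukirchANT1999, Ch. II §4 Prop. (4.3)] -/
theorem map_mem_integer_of_v_eq (hvσ : ∀ x, Valued.v (σ x) = Valued.v x) (x : 𝒪[K]) : σ x ∈ 𝒪[K] := by
  change Valued.v (σ x) ≤ 1
  rw [hvσ]
  exact x.2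

/-- **`σk`, `hσk`: a valuation-preserving `σ` REDUCES TO THE RESIDUE FIELD** — there is `σk : 𝓀 →+* 𝓀` with `σk (x mod 𝔪) = σ x mod 𝔪` (`σ` maps `𝔪 = {|x| < 1}` to itself;
`σk = Ideal.quotientMap 𝔪 σ|_𝒪`).  The pair `(σk, hσk)` of ★ `UnitaryGroupReductionSurjective` ∕ ★ T1e V2b–V4, in the `Valued` presentation. [cite: NeukirchANT1999, Ch. II §4 Prop. (4.3)] -/
theorem exists_residueField_ringHom_of_v_eq (hvσ : ∀ x, Valued.v (σ x) = Valued.v x) :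
    ∃ σk : 𝓀[K] →+* 𝓀[K], ∀ x : 𝒪[K], IsLocalRing.residue 𝒪[K] ⟨σ x, map_mem_integer_of_v_eq hvσ x⟩ = σk (IsLocalRing.residue 𝒪[K] x) := by
  -- the restriction `σO : 𝒪 →+* 𝒪`
  let σO : 𝒪[K] →+* 𝒪[K] := (σ.comp (𝒪[K]).subtype).codRestrict 𝒪[K] fun x => map_mem_integer_of_v_eq hvσ x
  have hσO : ∀ x : 𝒪[K], ((σO x : 𝒪[K]) : K) = σ x := fun _ => rfl
  -- `σO` maps `𝔪` into `𝔪`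
  have hle : IsLocalRing.maximalIdeal 𝒪[K] ≤ (IsLocalRing.maximalIdeal 𝒪[K]).comap σO := by
    intro x hx
    rw [Ideal.mem_comap, ← IsLocalRing.residue_eq_zero_iff, residue_eq_zero_iff_v_lt_one, hσO, hvσ]
    exact (residue_eq_zero_iff_v_lt_one x).1 ((IsLocalRing.residue_eq_zero_iff _).2 hx)
  refine ⟨Ideal.quotientMap _ σO hle, fun x => ?_⟩
  have hx : (⟨σ x, map_mem_integer_of_v_eq hvσ x⟩ : 𝒪[K]) = σO x := rfl
  rw [hx]
  rfl

end Generic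

/-! ## §2 An inert place of a quadratic extension of number fields: the reduction of `σ_w` is the `q_v`-Frobenius and `|𝓀[E_w]| = q_v²` -/

section InertPlace

open _root_.NumberField _root_.IsDedekindDomain Literature.NumberTheory.Automorphic.UnitaryGroup

variable {F E : Type} [Field F] [NumberField F] [Field E] [NumberField E] [Algebra F E] [Algebra.IsQuadraticExtension F E]
  (c : E ≃ₐ[F] E) (v : HeightOneSpectrum (𝓞 F))

omit [NumberField F] [Algebra.IsQuadraticExtension F E] in
/-- **`hσO` at a non-split place**: `σ_w = galAdicCompletionMap c hw` maps `𝒪[E_w] = Valued.integer E_w` into itself (★ `valued_galAdicCompletionMap`).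
[cite: NeukirchANT1999, Ch. II §4 Prop. (4.3)] -/
theorem galAdicCompletionMap_mem_valuedInteger (w : UnitaryGroup.PlacesOver E v) (hw : c • w.1 = w.1) (x : 𝒪[w.1.adicCompletion E]) :
    galAdicCompletionMap (L := E) c hw x ∈ 𝒪[w.1.adicCompletion E] :=
  map_mem_integer_of_v_eq (fun y => valued_galAdicCompletionMap (L := E) c hw y) x

/-- **`hfrob` at an INERT place: every reduction `σk` of `σ_w` is `y ↦ y ^ q_v`** (`v` unramified in `E`, `c • w = w`, `c ≠ 1`; `Valued` presentation of ★
`residueHom_galAdicCompletionMap_eq_pow`). [cite: NeukirchANT1999, Ch. I §9 Exercise 2 and Ch. II §4 Prop. (4.3)] -/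
theorem residueHom_galAdicCompletionMap_eq_pow_valued (hc : c ≠ 1) (hv : Algebra.IsUnramifiedIn (𝓞 E) v.asIdeal) (w : UnitaryGroup.PlacesOver E v) (hw : c • w.1 = w.1)
    (σk : 𝓀[w.1.adicCompletion E] →+* 𝓀[w.1.adicCompletion E])
    (hσk : ∀ x : 𝒪[w.1.adicCompletion E],
      IsLocalRing.residue 𝒪[w.1.adicCompletion E] ⟨galAdicCompletionMap (L := E) c hw x, galAdicCompletionMap_mem_valuedInteger c v w hw x⟩ =
        σk (IsLocalRing.residue 𝒪[w.1.adicCompletion E] x))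
    (y : 𝓀[w.1.adicCompletion E]) : σk y = y ^ Nat.card (𝓞 F ⧸ v.asIdeal) := by
  obtain ⟨x, rfl⟩ := IsLocalRing.residue_surjective y
  rw [← hσk, ← map_pow, ← sub_eq_zero, ← map_sub, residue_eq_zero_iff_v_lt_one]
  push_cast
  exact Liu2021.LemD1IndexedNonVacuityInertConverse.valued_galAdicCompletionMap_sub_pow_lt_one E c v hc hv w hw x x.2

/-- **`hk` at an INERT place: `Fintype.card 𝓀[E_w] = q_v ^ 2`** for the `Valued` residue field `𝓀[E_w] = ResidueField (w.adicCompletionIntegers E)` (★ `natCard_residueField_adicCompletion` +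
★ `card_residueField_eq_sq`: `f(w|v) = 2`), any `Fintype` instance. [cite: NeukirchANT1999, Ch. I §8 Prop. (8.2) and Ch. II §4 Prop. (4.3)] -/
theorem fintypeCard_valuedResidueField_eq_sq_of_inert (hc : c ≠ 1) (hv : Algebra.IsUnramifiedIn (𝓞 E) v.asIdeal) (w : UnitaryGroup.PlacesOver E v) (hw : c • w.1 = w.1)
    [Fintype 𝓀[w.1.adicCompletion E]] : Fintype.card 𝓀[w.1.adicCompletion E] = Nat.card (𝓞 F ⧸ v.asIdeal) ^ 2 := by
  rw [← Nat.card_eq_fintype_card, IsDedekindDomain.HeightOneSpectrum.natCard_residueField_adicCompletion E w.1,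
    Liu2021.LemD1IndexedNonVacuityInertFrobenius.card_residueField_eq_sq E c v hc hv w hw]

/-! ## §3 The inert-place heads: the `U(3)` lattice tree of `E_w³` is `(q_v³+1, q_v+1)`-bi-regular -/

omit [NumberField F] [Algebra.IsQuadraticExtension F E] in
/-- **`hnb` AT AN INERT PLACE — every star of the lattice tree of `(E_w³, J₀)` is finite**, for every uniformiser `ϖ` carrying the unramified datum of `σ_w`
(★ `UnitaryGroup.unramifiedLocalConjDatum_adicCompletion` provides one). [cite: BruhatTits1972, §10] [cite: Tits1979, §2.4] -/
theorem finite_neighborSet_inert (w : UnitaryGroup.PlacesOver E v) (hw : c • w.1 = w.1) {ϖ : w.1.adicCompletion E}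
    (hd : UnramifiedLocalConjDatum (galAdicCompletionMap (L := E) c hw) ϖ)
    (x : {M : Submodule 𝒪[w.1.adicCompletion E] (Fin 3 → w.1.adicCompletion E) //
      IsVertex (galAdicCompletionMap (L := E) c hw) ϖ ((StdForm.antidiagonal 3).over (w.1.adicCompletion E)) M}) :
    ((latticeGraph (galAdicCompletionMap (L := E) c hw) ϖ ((StdForm.antidiagonal 3).over (w.1.adicCompletion E))).neighborSet x).Finite := by
  obtain ⟨σk, hσk⟩ := exists_residueField_ringHom_of_v_eq (K := w.1.adicCompletion E) (fun y => valued_galAdicCompletionMap (L := E) c hw y)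
  exact finite_neighborSet hd (galAdicCompletionMap_mem_valuedInteger c v w hw) σk hσk x

/-- **`hdeg` AT AN INERT PLACE — `(G.neighborSet x).ncard = ![q_v³, q_v] (t x) + 1`** for any type function `t` (`t x = 0 ↔ x` self-dual) of the lattice tree of `(E_w³, J₀)`:
`v` unramified in `E`, `c • w = w`, `c ≠ 1`, `q_v = |𝓞_F ∕ 𝔭_v|`. [cite: Tits1979, §2.4] [cite: BruhatTits1972, §10] [cite: Serre1980Trees, II.1.1] -/
theorem ncard_neighborSet_eq_typeFun_inert (hc : c ≠ 1) (hv : Algebra.IsUnramifiedIn (𝓞 E) v.asIdeal) (w : UnitaryGroup.PlacesOver E v) (hw : c • w.1 = w.1)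
    {ϖ : w.1.adicCompletion E} (hd : UnramifiedLocalConjDatum (galAdicCompletionMap (L := E) c hw) ϖ)
    {t : {M : Submodule 𝒪[w.1.adicCompletion E] (Fin 3 → w.1.adicCompletion E) //
      IsVertex (galAdicCompletionMap (L := E) c hw) ϖ ((StdForm.antidiagonal 3).over (w.1.adicCompletion E)) M} → Fin 2}
    (ht0 : ∀ x, t x = 0 ↔ IsSelfDualLattice (galAdicCompletionMap (L := E) c hw) ϖ ((StdForm.antidiagonal 3).over (w.1.adicCompletion E)) x.1)
    (x : {M : Submodule 𝒪[w.1.adicCompletion E] (Fin 3 → w.1.adicCompletion E) //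
      IsVertex (galAdicCompletionMap (L := E) c hw) ϖ ((StdForm.antidiagonal 3).over (w.1.adicCompletion E)) M}) :
    ((latticeGraph (galAdicCompletionMap (L := E) c hw) ϖ ((StdForm.antidiagonal 3).over (w.1.adicCompletion E))).neighborSet x).ncard =
      (![Nat.card (𝓞 F ⧸ v.asIdeal) ^ 3, Nat.card (𝓞 F ⧸ v.asIdeal)] : Fin 2 → ℕ) (t x) + 1 := by
  letI : Fintype 𝓀[w.1.adicCompletion E] := Fintype.ofFinite _
  obtain ⟨σk, hσk⟩ := exists_residueField_ringHom_of_v_eq (K := w.1.adicCompletion E) (fun y => valued_galAdicCompletionMap (L := E) c hw y)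
  exact ncard_neighborSet_eq_typeFun hd (galAdicCompletionMap_mem_valuedInteger c v w hw) σk hσk (fintypeCard_valuedResidueField_eq_sq_of_inert c v hc hv w hw)
    (residueHom_galAdicCompletionMap_eq_pow_valued c v hc hv w hw σk hσk) ht0 x

/-- **A SELF-DUAL VERTEX HAS `q_v³ + 1` NEIGHBOURS at an inert place.** [cite: Tits1979, §2.4] [cite: BruhatTits1972, §10] -/
theorem ncard_neighborSet_of_isSelfDualLattice_inert (hc : c ≠ 1) (hv : Algebra.IsUnramifiedIn (𝓞 E) v.asIdeal) (w : UnitaryGroup.PlacesOver E v) (hw : c • w.1 = w.1)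
    {ϖ : w.1.adicCompletion E} (hd : UnramifiedLocalConjDatum (galAdicCompletionMap (L := E) c hw) ϖ)
    (x : {M : Submodule 𝒪[w.1.adicCompletion E] (Fin 3 → w.1.adicCompletion E) //
      IsVertex (galAdicCompletionMap (L := E) c hw) ϖ ((StdForm.antidiagonal 3).over (w.1.adicCompletion E)) M})
    (hx : IsSelfDualLattice (galAdicCompletionMap (L := E) c hw) ϖ ((StdForm.antidiagonal 3).over (w.1.adicCompletion E)) x.1) :
    ((latticeGraph (galAdicCompletionMap (L := E) c hw) ϖ ((StdForm.antidiagonal 3).over (w.1.adicCompletion E))).neighborSet x).ncard =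
      Nat.card (𝓞 F ⧸ v.asIdeal) ^ 3 + 1 := by
  letI : Fintype 𝓀[w.1.adicCompletion E] := Fintype.ofFinite _
  obtain ⟨σk, hσk⟩ := exists_residueField_ringHom_of_v_eq (K := w.1.adicCompletion E) (fun y => valued_galAdicCompletionMap (L := E) c hw y)
  exact ncard_neighborSet_of_isSelfDualLattice hd (galAdicCompletionMap_mem_valuedInteger c v w hw) σk hσk
    (fintypeCard_valuedResidueField_eq_sq_of_inert c v hc hv w hw) (residueHom_galAdicCompletionMap_eq_pow_valued c v hc hv w hw σk hσk) x hx

/-- **A TYPE-TWO VERTEX HAS `q_v + 1` NEIGHBOURS at an inert place.** [cite: Tits1979, §2.4] [cite: BruhatTits1972, §10] -/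
theorem ncard_neighborSet_of_isVertexLattice_two_inert (hc : c ≠ 1) (hv : Algebra.IsUnramifiedIn (𝓞 E) v.asIdeal) (w : UnitaryGroup.PlacesOver E v) (hw : c • w.1 = w.1)
    {ϖ : w.1.adicCompletion E} (hd : UnramifiedLocalConjDatum (galAdicCompletionMap (L := E) c hw) ϖ)
    (x : {M : Submodule 𝒪[w.1.adicCompletion E] (Fin 3 → w.1.adicCompletion E) //
      IsVertex (galAdicCompletionMap (L := E) c hw) ϖ ((StdForm.antidiagonal 3).over (w.1.adicCompletion E)) M})
    (hx : IsVertexLattice (galAdicCompletionMap (L := E) c hw) ϖ ((StdForm.antidiagonal 3).over (w.1.adicCompletion E)) 2 x.1) :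
    ((latticeGraph (galAdicCompletionMap (L := E) c hw) ϖ ((StdForm.antidiagonal 3).over (w.1.adicCompletion E))).neighborSet x).ncard =
      Nat.card (𝓞 F ⧸ v.asIdeal) + 1 := by
  letI : Fintype 𝓀[w.1.adicCompletion E] := Fintype.ofFinite _
  obtain ⟨σk, hσk⟩ := exists_residueField_ringHom_of_v_eq (K := w.1.adicCompletion E) (fun y => valued_galAdicCompletionMap (L := E) c hw y)
  exact ncard_neighborSet_of_isVertexLattice_two hd (galAdicCompletionMap_mem_valuedInteger c v w hw) σk hσk
    (fintypeCard_valuedResidueField_eq_sq_of_inert c v hc hv w hw) (residueHom_galAdicCompletionMap_eq_pow_valued c v hc hv w hw σk hσk) x hx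

/-- **THE SPHERES AROUND A HYPERSPECIAL VERTEX at an inert place**: `#{y | dist(x, y) = m} = (q_v³ + 1) · q_v^{⌊m∕2⌋} · (q_v³)^{⌊(m−1)∕2⌋}` for `m ≥ 1`.
[cite: Serre1980Trees, II.1.1] [cite: Tits1979, §2.4] -/
theorem ncard_sphere_of_isSelfDualLattice_inert (hc : c ≠ 1) (hv : Algebra.IsUnramifiedIn (𝓞 E) v.asIdeal) (w : UnitaryGroup.PlacesOver E v) (hw : c • w.1 = w.1)
    {ϖ : w.1.adicCompletion E} (hd : UnramifiedLocalConjDatum (galAdicCompletionMap (L := E) c hw) ϖ)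
    (x : {M : Submodule 𝒪[w.1.adicCompletion E] (Fin 3 → w.1.adicCompletion E) //
      IsVertex (galAdicCompletionMap (L := E) c hw) ϖ ((StdForm.antidiagonal 3).over (w.1.adicCompletion E)) M})
    (hx : IsSelfDualLattice (galAdicCompletionMap (L := E) c hw) ϖ ((StdForm.antidiagonal 3).over (w.1.adicCompletion E)) x.1) {m : ℕ} (hm : 1 ≤ m) :
    {y | (latticeGraph (galAdicCompletionMap (L := E) c hw) ϖ ((StdForm.antidiagonal 3).over (w.1.adicCompletion E))).dist x y = m}.ncard =
      (Nat.card (𝓞 F ⧸ v.asIdeal) ^ 3 + 1) * Nat.card (𝓞 F ⧸ v.asIdeal) ^ (m / 2) * (Nat.card (𝓞 F ⧸ v.asIdeal) ^ 3) ^ ((m - 1) / 2) := by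
  letI : Fintype 𝓀[w.1.adicCompletion E] := Fintype.ofFinite _
  obtain ⟨σk, hσk⟩ := exists_residueField_ringHom_of_v_eq (K := w.1.adicCompletion E) (fun y => valued_galAdicCompletionMap (L := E) c hw y)
  exact ncard_sphere_of_isSelfDualLattice hd (galAdicCompletionMap_mem_valuedInteger c v w hw) σk hσk
    (fintypeCard_valuedResidueField_eq_sq_of_inert c v hc hv w hw) (residueHom_galAdicCompletionMap_eq_pow_valued c v hc hv w hw σk hσk) x hx hm

/-- **`q_v⁴ + q_v` HYPERSPECIAL VERTICES AT DISTANCE `2`** from a hyperspecial vertex at an inert place — the `q_v⁴ + q_v` points of `K_v t K_v ∕ K_v` (★ `HyperspecialUnitaryRankOneHeckeNeighbours`).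
[cite: Serre1980Trees, II.1.1] [cite: Tits1979, §2.4] -/
theorem ncard_sphere_two_of_isSelfDualLattice_inert (hc : c ≠ 1) (hv : Algebra.IsUnramifiedIn (𝓞 E) v.asIdeal) (w : UnitaryGroup.PlacesOver E v) (hw : c • w.1 = w.1)
    {ϖ : w.1.adicCompletion E} (hd : UnramifiedLocalConjDatum (galAdicCompletionMap (L := E) c hw) ϖ)
    (x : {M : Submodule 𝒪[w.1.adicCompletion E] (Fin 3 → w.1.adicCompletion E) //
      IsVertex (galAdicCompletionMap (L := E) c hw) ϖ ((StdForm.antidiagonal 3).over (w.1.adicCompletion E)) M})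
    (hx : IsSelfDualLattice (galAdicCompletionMap (L := E) c hw) ϖ ((StdForm.antidiagonal 3).over (w.1.adicCompletion E)) x.1) :
    {y | (latticeGraph (galAdicCompletionMap (L := E) c hw) ϖ ((StdForm.antidiagonal 3).over (w.1.adicCompletion E))).dist x y = 2}.ncard =
      Nat.card (𝓞 F ⧸ v.asIdeal) ^ 4 + Nat.card (𝓞 F ⧸ v.asIdeal) := by
  letI : Fintype 𝓀[w.1.adicCompletion E] := Fintype.ofFinite _
  obtain ⟨σk, hσk⟩ := exists_residueField_ringHom_of_v_eq (K := w.1.adicCompletion E) (fun y => valued_galAdicCompletionMap (L := E) c hw y)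
  exact ncard_sphere_two_of_isSelfDualLattice hd (galAdicCompletionMap_mem_valuedInteger c v w hw) σk hσk
    (fintypeCard_valuedResidueField_eq_sq_of_inert c v hc hv w hw) (residueHom_galAdicCompletionMap_eq_pow_valued c v hc hv w hw σk hσk) x hx

end InertPlace

end Literature.NumberTheory.Automorphic.UnitaryLatticeTree

end
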